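import Literature.NumberTheory.EllipticCurves.TunnellHalfIntegralFormsProofs
import Literature.NumberTheory.EllipticCurves.HalfIntegralWeightThetaMultiplier
import HarnessLib

/-!
# `θ_s(z) = θ(sz)` at an arbitrary cusp: the expansion of `θ_s(gz)`, `g ∈ SL₂(ℤ)`, `c > 0`,
# and its limit as `Im z → ∞`

Second step (after `TunnellThetaAutomorphyProofs`) towards the membership
`g θ_t ∈ S_{3/2}(128, χ)` of Tunnell's forms (Tunnell 1983, p. 327; the cusp-form half of Thm 2 and
condition (M) of `Tunnell1983_waldspurger_triv_iff`): the behaviour of the one-variable theta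
series `θ_s(z) = ∑_m e^{2πi s m² z} = θ(sz)` (`thetaMul s`) at every cusp `g · ∞` of `SL₂(ℤ)`, which
is what the cusp condition `slashSq 3 f g → 0` of `halfIntCuspForms` asks about. We PROVE, for
`g = (a b; c d) ∈ SL₂(ℤ)` with `c > 0`, `s ≥ 1` and `α = gcd(s, c)`, `s = αδ`, `c = αc''`:

* `thetaMul_smul_eq_tsum` — **the expansion at the cusp**
  `θ_s(gz) = (2i c''δ/(cz + d))^{-1/2} ∑_{k ∈ ℤ} exp(πi k² (cz + d)/(2c''δ)) G(aδ, k; c'')`,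
  `G(a, k; c) = ∑_{r mod c} e((a r² + k r)/c)` (`quadGaussSum`). Proof: `diag(s, 1) g = g'' (α β; 0 δ)`
  with `g'' = (aδ, αb - aβ; c'', d'') ∈ SL₂(ℤ)`, `β = d x`, `d'' = d y` for a Bézout relation
  `c'' x + δ y = 1` (`gcd(c'', δ) = 1`), so that `s · gz = g''(w)`, `w = (αz + β)/δ`,
  `c'' w + d'' = (cz + d)/δ`; then the transformation law (★) of `θ` under all of `SL₂(ℤ)`
  (`shimuraTheta_smul_eq_tsum`, Poisson summation) for `g''` at `w`.
* `tendsto_tsum_thetaTail` — the series tends to its `k = 0` term `G(aδ; c'')` as `Im z → ∞`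
  (dominated convergence, `|G(·, k; c'')| ≤ c''`, `|exp(πi k² (cz+d)/(2m))| = e^{-π k² c Im z/(2m)}`).
* `prefactor_eq`, `prefactor_sq_div` — `(2im/(cz + d))^{-1/2} = m^{-1/2} P(z)` with the common
  prefactor `P(z) = (2i/(cz + d))^{-1/2}`, and `P(z)²/(cz + d) = 1/(2i)`.
* `tendsto_thetaMul_div_prefactor` — **`θ_s(gz)/P(z) → G(aδ; c'')/√(c''δ)`** at `i∞`; so
  `θ_s(gz)² / (cz + d) → G(aδ; c'')²/(2i c''δ)`: `θ_s` is holomorphic at every cusp, and vanishes at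
  `g · ∞` iff `G(aδ; c'') = 0` (iff `c'' ≡ 2 mod 4`, i.e. `2s ∥ c`; not needed below).

The sequel combines these limits for `s = 1, 4, 8, 32` to show that `(θ₁ - θ₄)(2θ₃₂ - θ₈) = 2g`
vanishes at every cusp (`16 ∣ c`: `G(a; c) = 2 G(a; c/4)`; `16 ∤ c`: `G(4a'; c'') = G(a'; c'')`,
`c''` odd), hence so does every `g θ_t`.

## References

* G. Shimura, *On modular forms of half integral weight*, Ann. of Math. 97 (1973) 440–481, §1
  (transformation formulae of `θ`), §2 (theta series of weight `1/2`). [Shimura1973HalfIntegral]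
* N. Koblitz, *Introduction to Elliptic Curves and Modular Forms*, GTM 97, Ch. III §3, Ch. IV §1
  (`θ` under `SL₂(ℤ)` by Poisson summation; behaviour at the cusps). [KoblitzECMF1993]
* J. B. Tunnell, Invent. Math. 72 (1983), p. 326 (`θ_t ∈ M_{1/2}(4t, χ_t)`), p. 327.
  [Tunnell1983Congruent]
-/

noncomputable section

open scoped MatrixGroups

open UpperHalfPlane hiding I
open Complex Filter Topology
open scoped Real

namespace Literature.NumberTheory.EllipticCurves.Tunnell1983

open Literature.NumberTheory.EllipticCurves.ModularForms

/-! ### The decomposition `diag(s, 1) g = g'' (α β; 0 δ)` and the expansion of `θ_s(gz)` -/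

section Expansion

variable {c : ℕ} [NeZero c]

/-- `Im ((α z + β)/δ) = α Im z / δ > 0` for `α, δ ≥ 1`. [folklore] -/
theorem im_affine_pos {α δ : ℕ} (hα : 0 < α) (hδ : 0 < δ) (β : ℤ) (z : ℍ) :
    0 < (((α : ℂ) * z + β) / δ).im := by
  rw [Complex.div_natCast_im]
  have : ((α : ℂ) * z + β).im = α * z.im := by simp
  rw [this]
  have hα' : (0 : ℝ) < α := by exact_mod_cast hα
  have hδ' : (0 : ℝ) < δ := by exact_mod_cast hδ
  exact div_pos (mul_pos hα' z.im_pos) hδ'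

/-- If `α = gcd(s, c)`, `s = α δ`, `c = α c''` (`α ≥ 1`) then `gcd(c'', δ) = 1`. [folklore] -/
theorem coprime_of_gcd_eq {s c α δ c'' : ℕ} (hα : α = Nat.gcd s c) (hδ : s = α * δ)
    (hc'' : c = α * c'') (hαpos : 0 < α) : Nat.Coprime c'' δ := by
  have h := Nat.gcd_mul_left α δ c''
  rw [← hδ, ← hc'', ← hα] at h
  have h2 : α * Nat.gcd δ c'' = α * 1 := by rw [mul_one]; exact h.symm
  exact Nat.Coprime.symm (Nat.eq_of_mul_eq_mul_left hαpos h2)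

/-- **`θ_s(gz)` at an arbitrary cusp.** Let `g = (a b; c d) ∈ SL₂(ℤ)` with `c > 0`, `s ≥ 1`,
`α = gcd(s, c)`, `δ = s/α`, `c'' = c/α`. Then
`θ_s(gz) = (2i c''δ/(cz + d))^{-1/2} · ∑_k exp(πi k² (cz + d)/(2 c''δ)) · G(aδ, k; c'')`.
Indeed `diag(s, 1) g = g'' (α β; 0 δ)` with `g'' = (aδ, αb - aβ; c'', d'') ∈ SL₂(ℤ)`
(`β = d x`, `d'' = d y` for a Bézout relation `c'' x + δ y = 1`), so `s · gz = g'' w`,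
`w = (αz + β)/δ`, `c'' w + d'' = (cz + d)/δ`, and the transformation law (★) of `θ` under `SL₂(ℤ)`
(`shimuraTheta_smul_eq_tsum`, Poisson summation) applies to `g''` at `w`.
[cite: Shimura1973HalfIntegral, §1] [cite: KoblitzECMF1993, Ch. III §3 and Ch. IV §1] -/
theorem thetaMul_smul_eq_tsum {g : SL(2, ℤ)} (hc : (g 1 0 : ℤ) = c) {s α δ c'' : ℕ} [NeZero c'']
    (hs : 0 < s) (hα : α = Nat.gcd s c) (hδ : s = α * δ) (hc'' : c = α * c'') (z : ℍ) :
    thetaMul s (g • z) =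
      1 / (2 * I * ((c'' * δ : ℕ) : ℂ) / ((c : ℂ) * z + g 1 1)) ^ (1 / 2 : ℂ) *
        ∑' k : ℤ, cexp (π * I * k ^ 2 * (((c : ℂ) * z + g 1 1) / (2 * ((c'' * δ : ℕ) : ℂ)))) *
          quadGaussSum c'' (((g 0 0 : ℤ) * δ : ℤ) : ZMod c'') k := by
  -- positivity bookkeeping
  have hcpos : 0 < c := Nat.pos_of_ne_zero (NeZero.ne c)
  have hαpos : 0 < α := by rw [hα]; exact Nat.gcd_pos_of_pos_right _ hcpos
  have hδpos : 0 < δ := by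
    rcases Nat.eq_zero_or_pos δ with h0 | h0
    · rw [h0, mul_zero] at hδ; omega
    · exact h0
  have hδ0 : (δ : ℂ) ≠ 0 := by exact_mod_cast hδpos.ne'
  have hcop : Nat.Coprime c'' δ := coprime_of_gcd_eq hα hδ hc'' hαpos
  -- a Bézout relation `c'' x + δ y = 1`
  set x : ℤ := Int.gcdA c'' δ with hx
  set y : ℤ := Int.gcdB c'' δ with hy
  have hxy : (c'' : ℤ) * x + δ * y = 1 := by
    have h := Int.gcd_eq_gcd_ab (c'' : ℤ) δ
    rw [Int.gcd_natCast_natCast, hcop] at h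
    simpa using h.symm
  -- notation for the entries of `g`
  set a : ℤ := g 0 0 with ha
  set b : ℤ := g 0 1 with hb
  set d : ℤ := g 1 1 with hd
  -- the matrix `g''` (`β = d x`, `d'' = d y`)
  have hdet : (a * δ) * (d * y) - (α * b - a * (d * x)) * c'' = 1 := by
    have h1 := det_eq_one' g
    rw [hc, hc'', ← ha, ← hb, ← hd] at h1
    push_cast at h1
    linear_combination h1 + (a * d) * hxy
  set g'' : SL(2, ℤ) := ⟨!![a * δ, α * b - a * (d * x); c'', d * y], by
    rw [Matrix.det_fin_two_of]; linear_combination hdet⟩ with hg''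
  have e00 : (g'' 0 0 : ℤ) = a * δ := rfl
  have e01 : (g'' 0 1 : ℤ) = α * b - a * (d * x) := rfl
  have e10 : (g'' 1 0 : ℤ) = c'' := rfl
  have e11 : (g'' 1 1 : ℤ) = d * y := rfl
  -- the point `w = (α z + β)/δ` and `c'' w + d'' = (cz + d)/δ`
  set w : ℍ := UpperHalfPlane.mk (((α : ℂ) * z + ((d * x : ℤ) : ℂ)) / δ)
    (im_affine_pos hαpos hδpos (d * x) z) with hw
  have ew : ((w : ℍ) : ℂ) = ((α : ℂ) * z + ((d * x : ℤ) : ℂ)) / δ := rfl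
  have hxy' : (c'' : ℂ) * x + δ * y = 1 := by exact_mod_cast hxy
  have hβ' : (c'' : ℂ) * ((d : ℂ) * x) + d * y * δ = d := by
    linear_combination (d : ℂ) * hxy'
  have hden : (c'' : ℂ) * w + ((d * y : ℤ) : ℂ) = ((c : ℂ) * z + d) / δ := by
    rw [ew, ← mul_div_assoc, Int.cast_mul, div_add' _ _ _ hδ0]
    congr 1
    rw [hc'']
    push_cast
    linear_combination hβ'
  -- `s · gz = g'' w`
  have hw0 : (c : ℂ) * z + d ≠ 0 := by
    have := im_denom_pos (c := c) d z
    intro h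
    rw [h] at this
    simp at this
  have hpt : UpperHalfPlane.mk ((s : ℂ) * ↑(g • z)) (mul_im_pos hs (g • z)) = g'' • w := by
    apply UpperHalfPlane.ext
    have eγz : ((UpperHalfPlane.mk ((s : ℂ) * ↑(g • z)) (mul_im_pos hs (g • z)) : ℍ) : ℂ) =
        (s : ℂ) * ↑(g • z) := rfl
    rw [eγz, coe_smul_eq' g'', e00, e01, e10, e11, coe_smul_eq' g, hc, ← ha, ← hb, ← hd]
    have hden' := hden
    push_cast at hden' ⊢
    rw [hden', ew, hδ]
    have hq : ((c : ℂ) * z + d) / δ ≠ 0 := div_ne_zero hw0 hδ0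
    push_cast
    field_simp
    ring
  rw [thetaMul_eq_shimuraTheta hs (g • z), hpt, shimuraTheta_smul_eq_tsum (γ := g'') e10 w, e00,
    e11, hden]
  have e1 : 2 * I * (c'' : ℂ) / (((c : ℂ) * z + d) / δ) =
      2 * I * ((c'' * δ : ℕ) : ℂ) / ((c : ℂ) * z + d) := by
    push_cast
    field_simp
  have e2 : ((c : ℂ) * z + d) / δ / (2 * (c'' : ℂ)) =
      ((c : ℂ) * z + d) / (2 * ((c'' * δ : ℕ) : ℂ)) := by
    have hc''0 : (c'' : ℂ) ≠ 0 := by exact_mod_cast (NeZero.ne c'')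
    push_cast
    field_simp
  rw [e1]
  congr 1
  exact tsum_congr fun k ↦ by rw [e2]

end Expansion

/-! ### The limit of the series at `i∞` -/

section Limit

variable {c : ℕ} [NeZero c]

/-- `Im z → ∞` along `atImInfty`. [folklore] -/
theorem tendsto_im_atImInfty : Tendsto (fun z : ℍ ↦ z.im) atImInfty atTop := by
  rw [atImInfty]
  exact tendsto_comap

omit [NeZero c] in
/-- Real part of the exponent: `Re(πi k² (cz + d)/(2m)) = -(π k² c/(2m)) Im z`. [folklore] -/
theorem re_exponent {m : ℕ} (k : ℤ) (d : ℤ) (z : ℍ) :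
    (π * I * k ^ 2 * (((c : ℂ) * z + d) / (2 * ((m : ℕ) : ℂ)))).re =
      -(π * k ^ 2 * c / (2 * m)) * z.im := by
  have e : (π : ℂ) * I * k ^ 2 * (((c : ℂ) * z + d) / (2 * ((m : ℕ) : ℂ))) =
      ((π * k ^ 2 / (2 * m) : ℝ) : ℂ) * (I * ((c : ℂ) * z + d)) := by
    push_cast
    ring
  rw [e, Complex.re_ofReal_mul, Complex.I_mul_re]
  simp
  ring

/-- **The series `∑_k exp(πi k² (cz + d)/(2m)) G(a'', k; c'')` tends to its `k = 0` term
`G(a''; c'')` as `Im z → ∞`** (`c, m ≥ 1`): dominated convergence with the bound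
`c'' exp(-π k² c/(2m))` on `Im z ≥ 1`. [folklore] -/
theorem tendsto_tsum_thetaTail {m c'' : ℕ} [NeZero m] [NeZero c''] (a'' : ZMod c'') (d : ℤ) :
    Tendsto (fun z : ℍ ↦ ∑' k : ℤ, cexp (π * I * k ^ 2 * (((c : ℂ) * z + d) / (2 * ((m : ℕ) : ℂ)))) *
      quadGaussSum c'' a'' k) atImInfty (𝓝 (quadGaussSum c'' a'' 0)) := by
  have hcpos : (0 : ℝ) < c := by exact_mod_cast Nat.pos_of_ne_zero (NeZero.ne c)
  have hmpos : (0 : ℝ) < m := by exact_mod_cast Nat.pos_of_ne_zero (NeZero.ne m)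
  set κ : ℝ := π * c / (2 * m) with hκ
  have hκpos : 0 < κ := by rw [hκ]; positivity
  -- the limit series `g k = [k = 0] G(a''; c'')`
  set G : ℤ → ℂ := fun k ↦ if k = 0 then quadGaussSum c'' a'' 0 else 0 with hG
  have hGsum : ∑' k : ℤ, G k = quadGaussSum c'' a'' 0 := by
    rw [hG]
    exact tsum_ite_eq 0 _
  rw [← hGsum]
  refine tendsto_tsum_of_dominated_convergence
    (bound := fun k : ℤ ↦ (c'' : ℝ) * Real.exp (-κ * k ^ 2)) ?_ ?_ ?_
  · exact (summable_exp_neg_mul_sq hκpos).mul_left _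
  · intro k
    by_cases hk : k = 0
    · subst hk
      simp only [hG, if_true, Int.cast_zero]
      have : ∀ z : ℍ, cexp (π * I * (0 : ℂ) ^ 2 * (((c : ℂ) * z + d) / (2 * ((m : ℕ) : ℂ)))) = 1 := by
        intro z; simp
      simp_rw [this, one_mul]
      exact tendsto_const_nhds
    · simp only [hG, if_neg hk]
      rw [tendsto_zero_iff_norm_tendsto_zero]
      have hbound : ∀ z : ℍ, ‖cexp (π * I * k ^ 2 * (((c : ℂ) * z + d) / (2 * ((m : ℕ) : ℂ)))) *
          quadGaussSum c'' a'' k‖ ≤ c'' * Real.exp (-(π * k ^ 2 * c / (2 * m)) * z.im) := by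
        intro z
        rw [norm_mul, Complex.norm_exp, re_exponent, mul_comm]
        exact mul_le_mul_of_nonneg_right (norm_quadGaussSum_le a'' k) (Real.exp_nonneg _)
      refine squeeze_zero (fun z ↦ norm_nonneg _) hbound ?_
      rw [show (0 : ℝ) = c'' * 0 by ring]
      refine Tendsto.const_mul _ ?_
      refine Real.tendsto_exp_atBot.comp ?_
      have hk2 : (0 : ℝ) < π * k ^ 2 * c / (2 * m) := by
        have : (k : ℝ) ^ 2 > 0 := by positivity
        positivity
      have h := tendsto_neg_atTop_atBot.comp (tendsto_im_atImInfty.const_mul_atTop hk2)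
      simpa only [Function.comp_def, neg_mul] using h
  · rw [Filter.eventually_iff_exists_mem]
    refine ⟨{z : ℍ | 1 ≤ z.im}, ?_, fun z hz k ↦ ?_⟩
    · rw [atImInfty_mem]
      exact ⟨1, fun z hz ↦ hz⟩
    · rw [norm_mul, Complex.norm_exp, re_exponent, mul_comm]
      refine mul_le_mul (norm_quadGaussSum_le a'' k) ?_ (Real.exp_nonneg _) (Nat.cast_nonneg _)
      apply Real.exp_le_exp.mpr
      have hz' : (1 : ℝ) ≤ z.im := hz
      have e : π * k ^ 2 * c / (2 * m) = κ * k ^ 2 := by rw [hκ]; ring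
      rw [e]
      have hK : 0 ≤ κ * k ^ 2 := by positivity
      nlinarith

end Limit

/-! ### The prefactor: `(2im/(cz + d))^{-1/2} = m^{-1/2} (2i/(cz + d))^{-1/2}` -/

section Prefactor

variable {c : ℕ} [NeZero c]

/-- `2i/(cz + d) ≠ 0`. [folklore] -/
theorem two_I_div_denom_ne_zero (d : ℤ) (z : ℍ) : 2 * I / ((c : ℂ) * z + d) ≠ 0 := by
  have hw := im_denom_pos (c := c) d z
  have hw0 : (c : ℂ) * z + d ≠ 0 := by
    intro h; rw [h] at hw; simp at hw
  exact div_ne_zero (mul_ne_zero two_ne_zero I_ne_zero) hw0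

/-- **`1/(2im/(cz + d))^{1/2} = (1/√m) · 1/(2i/(cz + d))^{1/2}`** for `m ≥ 1`: the prefactors of
the expansions of the `θ_s(gz)` differ from a common one by the positive factors `m^{-1/2}`
(principal branches; `cpow_half_div_natCast`). [folklore] -/
theorem prefactor_eq {m : ℕ} (hm : 0 < m) (d : ℤ) (z : ℍ) :
    1 / (2 * I * ((m : ℕ) : ℂ) / ((c : ℂ) * z + d)) ^ (1 / 2 : ℂ) =
      1 / (Real.sqrt m : ℂ) * (1 / (2 * I / ((c : ℂ) * z + d)) ^ (1 / 2 : ℂ)) := by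
  have hX : 2 * I * ((m : ℕ) : ℂ) / ((c : ℂ) * z + d) ≠ 0 := by
    have hm0 : ((m : ℕ) : ℂ) ≠ 0 := by exact_mod_cast hm.ne'
    have := two_I_div_denom_ne_zero (c := c) d z
    rw [show 2 * I * ((m : ℕ) : ℂ) / ((c : ℂ) * z + d) = ((m : ℕ) : ℂ) * (2 * I / ((c : ℂ) * z + d))
      by ring]
    exact mul_ne_zero hm0 this
  have key := cpow_half_div_natCast hX hm
  have e : 2 * I * ((m : ℕ) : ℂ) / ((c : ℂ) * z + d) / m = 2 * I / ((c : ℂ) * z + d) := by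
    have hm0 : ((m : ℕ) : ℂ) ≠ 0 := by exact_mod_cast hm.ne'
    field_simp
  rw [e] at key
  have hsq : (Real.sqrt m : ℂ) ≠ 0 := by
    exact_mod_cast (Real.sqrt_pos.mpr (by exact_mod_cast hm : (0 : ℝ) < m)).ne'
  rw [key]
  field_simp

/-- `(1/X^{1/2})² = 1/X`. [folklore] -/
theorem one_div_cpow_half_sq (X : ℂ) : (1 / X ^ (1 / 2 : ℂ)) ^ 2 = 1 / X := by
  rw [div_pow, one_pow, show (1 / 2 : ℂ) = ((2 : ℕ) : ℂ)⁻¹ by norm_num,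
    Complex.cpow_nat_inv_pow _ two_ne_zero]

/-- `(1/(2i/(cz + d))^{1/2})² / (cz + d) = 1/(2i)`. [folklore] -/
theorem prefactor_sq_div (d : ℤ) (z : ℍ) :
    (1 / (2 * I / ((c : ℂ) * z + d)) ^ (1 / 2 : ℂ)) ^ 2 / ((c : ℂ) * z + d) = 1 / (2 * I) := by
  rw [one_div_cpow_half_sq]
  have hw := im_denom_pos (c := c) d z
  have hw0 : (c : ℂ) * z + d ≠ 0 := by
    intro h; rw [h] at hw; simp at hw
  field_simp

end Prefactor


/-! ### The limit of `θ_s(gz)/P(z)`, `P(z) = (2i/(cz + d))^{-1/2}` -/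

section BracketLimit

variable {c : ℕ} [NeZero c]

/-- `P(z) = 1/(2i/(cz + d))^{1/2} ≠ 0`. [folklore] -/
theorem prefactor_ne_zero (d : ℤ) (z : ℍ) : 1 / (2 * I / ((c : ℂ) * z + d)) ^ (1 / 2 : ℂ) ≠ 0 := by
  refine div_ne_zero one_ne_zero ?_
  rw [Ne, Complex.cpow_eq_zero_iff, not_and_or]
  exact Or.inl (two_I_div_denom_ne_zero (c := c) d z)

/-- **`θ_s(gz)/P(z) → G(aδ; c'')/√(c''δ)`** as `Im z → ∞`, where `P(z) = (2i/(cz + d))^{-1/2}` is the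
common prefactor and `α = gcd(s, c)`, `s = αδ`, `c = αc''`: by `thetaMul_smul_eq_tsum`,
`θ_s(gz)/P(z) = (c''δ)^{-1/2} ∑_k exp(πi k² (cz + d)/(2c''δ)) G(aδ, k; c'')`, and the series tends to
its `k = 0` term. [folklore] -/
theorem tendsto_thetaMul_div_prefactor {g : SL(2, ℤ)} (hc : (g 1 0 : ℤ) = c) {s α δ c'' : ℕ}
    [NeZero c''] (hs : 0 < s) (hα : α = Nat.gcd s c) (hδ : s = α * δ) (hc'' : c = α * c'') :
    Tendsto (fun z : ℍ ↦ thetaMul s (g • z) / (1 / (2 * I / ((c : ℂ) * z + g 1 1)) ^ (1 / 2 : ℂ)))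
      atImInfty
      (𝓝 (quadGaussSum c'' (((g 0 0 : ℤ) * δ : ℤ) : ZMod c'') 0 / (Real.sqrt ((c'' * δ : ℕ) : ℝ) : ℂ))) := by
  have hδpos : 0 < δ := by
    rcases Nat.eq_zero_or_pos δ with h0 | h0
    · rw [h0, mul_zero] at hδ; omega
    · exact h0
  have hm : 0 < c'' * δ := Nat.mul_pos (Nat.pos_of_ne_zero (NeZero.ne c'')) hδpos
  haveI : NeZero (c'' * δ) := ⟨hm.ne'⟩
  have hsq : (Real.sqrt ((c'' * δ : ℕ) : ℝ) : ℂ) ≠ 0 := by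
    exact_mod_cast (Real.sqrt_pos.mpr (by exact_mod_cast hm : (0 : ℝ) < (c'' * δ : ℕ))).ne'
  have heq : (fun z : ℍ ↦ thetaMul s (g • z) / (1 / (2 * I / ((c : ℂ) * z + g 1 1)) ^ (1 / 2 : ℂ))) =
      fun z : ℍ ↦ (1 / (Real.sqrt ((c'' * δ : ℕ) : ℝ) : ℂ)) *
        ∑' k : ℤ, cexp (π * I * k ^ 2 * (((c : ℂ) * z + g 1 1) / (2 * ((c'' * δ : ℕ) : ℂ)))) *
          quadGaussSum c'' (((g 0 0 : ℤ) * δ : ℤ) : ZMod c'') k := by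
    funext z
    rw [thetaMul_smul_eq_tsum hc hs hα hδ hc'' z, prefactor_eq (c := c) hm (g 1 1) z]
    have hX : (2 * I / ((c : ℂ) * z + g 1 1)) ^ (1 / 2 : ℂ) ≠ 0 := by
      rw [Ne, Complex.cpow_eq_zero_iff, not_and_or]
      exact Or.inl (two_I_div_denom_ne_zero (c := c) (g 1 1) z)
    field_simp
  have elim : quadGaussSum c'' (((g 0 0 : ℤ) * δ : ℤ) : ZMod c'') 0 / (Real.sqrt ((c'' * δ : ℕ) : ℝ) : ℂ) =
      (1 / (Real.sqrt ((c'' * δ : ℕ) : ℝ) : ℂ)) * quadGaussSum c'' (((g 0 0 : ℤ) * δ : ℤ) : ZMod c'') 0 := by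
    ring
  rw [heq, elim]
  exact (tendsto_tsum_thetaTail (c := c) (m := c'' * δ) _ (g 1 1)).const_mul _

/-- The limit of `θ_s(gz)/P(z)` at `i∞` EXISTS for every `s ≥ 1` (with the parameters
`α = gcd(s, c)`, `δ = s/α`, `c'' = c/α`). [folklore] -/
theorem exists_tendsto_thetaMul_div_prefactor {g : SL(2, ℤ)} (hc : (g 1 0 : ℤ) = c) {s : ℕ}
    (hs : 0 < s) :
    ∃ L : ℂ, Tendsto
      (fun z : ℍ ↦ thetaMul s (g • z) / (1 / (2 * I / ((c : ℂ) * z + g 1 1)) ^ (1 / 2 : ℂ)))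
      atImInfty (𝓝 L) := by
  have hcpos : 0 < c := Nat.pos_of_ne_zero (NeZero.ne c)
  have hαpos : 0 < Nat.gcd s c := Nat.gcd_pos_of_pos_right _ hcpos
  have hδ : s = Nat.gcd s c * (s / Nat.gcd s c) := (Nat.mul_div_cancel' (Nat.gcd_dvd_left s c)).symm
  have hc'' : c = Nat.gcd s c * (c / Nat.gcd s c) := (Nat.mul_div_cancel' (Nat.gcd_dvd_right s c)).symm
  haveI : NeZero (c / Nat.gcd s c) :=
    ⟨(Nat.div_pos (Nat.le_of_dvd hcpos (Nat.gcd_dvd_right s c)) hαpos).ne'⟩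
  exact ⟨_, tendsto_thetaMul_div_prefactor hc hs rfl hδ hc''⟩

end BracketLimit

end Literature.NumberTheory.EllipticCurves.Tunnell1983
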